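import Mathlib
import Literature.NumberTheory.Sieve.ParityBarrier
import Literature.Probability.RandomGraphs.LowDegree
import HarnessLib

/-!
# Crux `MobiusLadder.LiouvilleOrthogonalTC0` (stmt-QuantumAdvantage-1393), line `Sketch`, skeleton v9:
stub `stub_scanRung` (A3) — padded finite-state scans of the `n` input bits

From a uniform Müllner-type bound `hFam` for `S`-state automata reading the canonical binary digits
`Nat.digits 2 m` (least-significant digit first) or their reversal, we derive: for every `ε > 0`,
eventually in `n`, for ALL `S`-state automata `(δ, q₀, τ)` over the alphabet `Bool`, the Boolean
function obtained by scanning the `n` bits `x₀, …, x_{n-1}` of `N < 2ⁿ` (`List.ofFn`, the high zero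
bits included), in either direction, is `ε 2ⁿ`-orthogonal to the Liouville function `λ`.

Proof. Dyadic induction on `n` (`scanRung_dyadic`): for `N < 2ⁿ` the scan of length `n + 1` reads
one more (zero) bit, which for the LSB-first scan replaces the output map `τ` by `τ ∘ δ(·, 0)` and
for the MSB-first scan replaces the initial state `q₀` by `δ(q₀, 0)` — so the sum over `N < 2ⁿ⁺¹`
is the sum over `N < 2ⁿ` for a shifted automaton of the same family plus the block
`2ⁿ ≤ N < 2ⁿ⁺¹`, on which `N` has exactly `n + 1` binary digits and the padded scan IS the
automaton reading `Nat.digits 2 N` (`scanRung_ofFn_testBit_eq`). The block is a difference of two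
of the partial sums bounded by `hFam` (`≤ ε' M` for `M ≥ N₀`, `≤ N₀` trivially below), whence
`|block| ≤ 3 ε' 2ⁿ + 2 N₀` uniformly in the automaton (`scanRung_block_bound`), and in total
`|Σ_{N < 2ⁿ}| ≤ 3 ε' 2ⁿ + 2 N₀ n ≤ ε 2ⁿ` for `ε' = ε / 6` and `n` large (`n / 2ⁿ → 0`).
-/

set_option linter.dupNamespace false -- D-0017: single-problem summit ⇒ `QuantumAdvantage.QuantumAdvantage` by design

noncomputable section

namespace Summit.QuantumAdvantage.QuantumAdvantage.Theorems.LiouvilleOrthogonalTC0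

open Filter Finset
open Literature.Probability.RandomGraphs.LowDegree (sgn)

/-! ### Binary digits versus `Nat.testBit` -/

/-- A number with exactly `n + 1` binary digits: the list of its `n + 1` low bits (`Nat.testBit`,
least significant first) is the list of its canonical binary digits `Nat.digits 2 N`, read as
Booleans. -/
theorem scanRung_ofFn_testBit_eq : ∀ (n N : ℕ), 2 ^ n ≤ N → N < 2 ^ (n + 1) →
    List.ofFn (fun i : Fin (n + 1) => Nat.testBit N i)
      = (Nat.digits 2 N).map (fun d => decide (d = 1))
  | 0, N, h1, h2 => by
    have h1' : 1 ≤ N := by simpa using h1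
    have h2' : N < 2 := by simpa using h2
    obtain rfl : N = 1 := le_antisymm (by omega) h1'
    simp [List.ofFn_succ]
  | k + 1, N, h1, h2 => by
    have hk1 : 2 ^ (k + 1) = 2 ^ k * 2 := Nat.pow_succ ..
    have hk2 : 2 ^ (k + 1 + 1) = 2 ^ k * 4 := by rw [Nat.pow_succ, Nat.pow_succ]; ring
    rw [List.ofFn_succ, Nat.digits_def' (by norm_num) (by omega), List.map_cons]
    congr 1
    · simp
    · rw [← scanRung_ofFn_testBit_eq k (N / 2) (by omega) (by omega)]
      simp [Nat.testBit_add_one]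

/-- LSB-first scan, one more (high, zero) bit: for `N < 2ⁿ` the scan of the `n + 1` low bits ends
in `δ (scan of the n low bits) false`. -/
theorem scanRung_foldl_succ {S : ℕ} (δ : Fin S → Bool → Fin S) (q₀ : Fin S) {n N : ℕ}
    (hN : N < 2 ^ n) :
    List.foldl δ q₀ (List.ofFn fun i : Fin (n + 1) => Nat.testBit N i)
      = δ (List.foldl δ q₀ (List.ofFn fun i : Fin n => Nat.testBit N i)) false := by
  rw [List.ofFn_succ']
  simp [Nat.testBit_lt_two_pow hN]

/-- MSB-first scan, one more (high, zero) bit: for `N < 2ⁿ` the reversed scan of the `n + 1` low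
bits is the reversed scan of the `n` low bits started at `δ q₀ false`. -/
theorem scanRung_foldl_reverse_succ {S : ℕ} (δ : Fin S → Bool → Fin S) (q₀ : Fin S) {n N : ℕ}
    (hN : N < 2 ^ n) :
    List.foldl δ q₀ (List.ofFn fun i : Fin (n + 1) => Nat.testBit N i).reverse
      = List.foldl δ (δ q₀ false) (List.ofFn fun i : Fin n => Nat.testBit N i).reverse := by
  rw [List.ofFn_succ']
  simp [Nat.testBit_lt_two_pow hN]

/-- On the block `2ⁿ ≤ N < 2ⁿ⁺¹` the LSB-first scan of the `n + 1` low bits is the automaton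
`δ' q d = δ q [d = 1]` reading `Nat.digits 2 N`. -/
theorem scanRung_foldl_block {S : ℕ} (δ : Fin S → Bool → Fin S) (q₀ : Fin S) {n N : ℕ}
    (h1 : 2 ^ n ≤ N) (h2 : N < 2 ^ (n + 1)) :
    List.foldl δ q₀ (List.ofFn fun i : Fin (n + 1) => Nat.testBit N i)
      = List.foldl (fun q d => δ q (decide (d = 1))) q₀ (Nat.digits 2 N) := by
  rw [scanRung_ofFn_testBit_eq n N h1 h2, List.foldl_map]

/-- On the block `2ⁿ ≤ N < 2ⁿ⁺¹` the MSB-first scan of the `n + 1` low bits is the automaton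
`δ' q d = δ q [d = 1]` reading `(Nat.digits 2 N).reverse`. -/
theorem scanRung_foldl_reverse_block {S : ℕ} (δ : Fin S → Bool → Fin S) (q₀ : Fin S) {n N : ℕ}
    (h1 : 2 ^ n ≤ N) (h2 : N < 2 ^ (n + 1)) :
    List.foldl δ q₀ (List.ofFn fun i : Fin (n + 1) => Nat.testBit N i).reverse
      = List.foldl (fun q d => δ q (decide (d = 1))) q₀ (Nat.digits 2 N).reverse := by
  rw [scanRung_ofFn_testBit_eq n N h1 h2, ← List.map_reverse, List.foldl_map]

/-! ### Bookkeeping -/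

/-- `|λ(m) · sgn b| ≤ 1` (`|λ| ≤ 1`: the tree's `Sieve.abs_liouville_le_one`). -/
theorem scanRung_abs_term_le (m : ℕ) (b : Bool) :
    |(ArithmeticFunction.liouville m : ℝ) * sgn b| ≤ 1 := by
  rw [abs_mul]
  have hb : |sgn b| = 1 := by cases b <;> simp
  rw [hb, mul_one]
  exact Literature.NumberTheory.Sieve.abs_liouville_le_one m

/-- Uniform form of a threshold bound on partial sums of a `1`-bounded sequence:
`|Σ_{m ≤ M} h m| ≤ ε' M` for `M ≥ N₀` gives `|Σ_{m ≤ M} h m| ≤ ε' M + N₀` for all `M`. -/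
theorem scanRung_prefix_bound {ε' : ℝ} (hε' : 0 ≤ ε') {N₀ : ℕ} {h : ℕ → ℝ}
    (hh : ∀ m, |h m| ≤ 1) (hP : ∀ M : ℕ, N₀ ≤ M → |∑ m ∈ range (M + 1), h m| ≤ ε' * M) (M : ℕ) :
    |∑ m ∈ range (M + 1), h m| ≤ ε' * M + N₀ := by
  rcases le_or_gt N₀ M with hM | hM
  · exact (hP M hM).trans (le_add_of_nonneg_right (Nat.cast_nonneg _))
  · calc |∑ m ∈ range (M + 1), h m| ≤ ∑ m ∈ range (M + 1), |h m| := abs_sum_le_sum_abs _ _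
      _ ≤ ∑ _m ∈ range (M + 1), (1 : ℝ) := sum_le_sum fun m _ => hh m
      _ = (M + 1 : ℕ) := by simp
      _ ≤ N₀ := by exact_mod_cast hM
      _ ≤ ε' * M + N₀ := le_add_of_nonneg_left (by positivity)

/-- The dyadic block `2ⁿ ≤ m < 2ⁿ⁺¹` of a `1`-bounded sequence whose partial sums are `≤ ε' M`
beyond `N₀`: `|Σ_{2ⁿ ≤ m < 2ⁿ⁺¹} h m| ≤ 3 ε' 2ⁿ + 2 N₀`. -/
theorem scanRung_block_bound {ε' : ℝ} (hε' : 0 ≤ ε') {N₀ : ℕ} {h : ℕ → ℝ}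
    (hh : ∀ m, |h m| ≤ 1) (hP : ∀ M : ℕ, N₀ ≤ M → |∑ m ∈ range (M + 1), h m| ≤ ε' * M) (n : ℕ) :
    |∑ m ∈ Ico (2 ^ n) (2 ^ (n + 1)), h m| ≤ 3 * ε' * 2 ^ n + 2 * N₀ := by
  obtain ⟨A, hA⟩ : ∃ A : ℕ, 2 ^ n = A + 1 := ⟨2 ^ n - 1, (Nat.sub_add_cancel Nat.one_le_two_pow).symm⟩
  obtain ⟨B, hB⟩ : ∃ B : ℕ, 2 ^ (n + 1) = B + 1 :=
    ⟨2 ^ (n + 1) - 1, (Nat.sub_add_cancel Nat.one_le_two_pow).symm⟩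
  have hAB : 2 ^ n ≤ 2 ^ (n + 1) := Nat.pow_le_pow_right (by norm_num) (Nat.le_succ n)
  rw [Finset.sum_Ico_eq_sub _ hAB, hA, hB]
  have hA' : (A : ℝ) ≤ 2 ^ n := by
    have : ((2 ^ n : ℕ) : ℝ) = A + 1 := by exact_mod_cast hA
    push_cast at this
    linarith
  have hB' : (B : ℝ) ≤ 2 * 2 ^ n := by
    have : ((2 ^ (n + 1) : ℕ) : ℝ) = B + 1 := by exact_mod_cast hB
    push_cast at this
    linarith [pow_succ (2 : ℝ) n]
  have h1 := scanRung_prefix_bound hε' hh hP B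
  have h2 := scanRung_prefix_bound hε' hh hP A
  calc |∑ m ∈ range (B + 1), h m - ∑ m ∈ range (A + 1), h m|
      ≤ |∑ m ∈ range (B + 1), h m| + |∑ m ∈ range (A + 1), h m| := abs_sub _ _
    _ ≤ (ε' * B + N₀) + (ε' * A + N₀) := add_le_add h1 h2
    _ ≤ (ε' * (2 * 2 ^ n) + N₀) + (ε' * 2 ^ n + N₀) := by gcongr
    _ = 3 * ε' * 2 ^ n + 2 * N₀ := by ring

/-- Dyadic induction: if lengthening the scan by one (zero) bit amounts to a shift `sh` of the
parameter, and every dyadic block is bounded by `a 2ⁿ + b` uniformly in the parameter, then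
`|Σ_{N < 2ⁿ} λ(N) G p n N| ≤ a (2ⁿ - 1) + b n`. -/
theorem scanRung_dyadic {P : Type*} (G : P → ℕ → ℕ → ℝ) (sh : P → P) (a b : ℝ)
    (hG : ∀ (p : P) (n N : ℕ), N < 2 ^ n → G p (n + 1) N = G (sh p) n N)
    (hB : ∀ (p : P) (n : ℕ), |∑ N ∈ Ico (2 ^ n) (2 ^ (n + 1)),
      ((ArithmeticFunction.liouville N : ℤ) : ℝ) * G p (n + 1) N| ≤ a * 2 ^ n + b) :
    ∀ (n : ℕ) (p : P), |∑ N ∈ range (2 ^ n), ((ArithmeticFunction.liouville N : ℤ) : ℝ) * G p n N|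
      ≤ a * (2 ^ n - 1) + b * n := by
  intro n
  induction n with
  | zero => intro p; simp
  | succ n ih =>
    intro p
    have hle : 2 ^ n ≤ 2 ^ (n + 1) := Nat.pow_le_pow_right (by norm_num) (Nat.le_succ n)
    rw [← Finset.sum_range_add_sum_Ico _ hle]
    have hlow : ∑ N ∈ range (2 ^ n), ((ArithmeticFunction.liouville N : ℤ) : ℝ) * G p (n + 1) N
        = ∑ N ∈ range (2 ^ n), ((ArithmeticFunction.liouville N : ℤ) : ℝ) * G (sh p) n N :=
      Finset.sum_congr rfl fun N hN => by rw [hG p n N (mem_range.mp hN)]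
    rw [hlow]
    calc _ ≤ |∑ N ∈ range (2 ^ n), ((ArithmeticFunction.liouville N : ℤ) : ℝ) * G (sh p) n N|
          + |∑ N ∈ Ico (2 ^ n) (2 ^ (n + 1)),
              ((ArithmeticFunction.liouville N : ℤ) : ℝ) * G p (n + 1) N| := abs_add_le _ _
      _ ≤ (a * (2 ^ n - 1) + b * n) + (a * 2 ^ n + b) := add_le_add (ih (sh p)) (hB p n)
      _ = a * (2 ^ (n + 1) - 1) + b * (n + 1 : ℕ) := by push_cast; ring

/-- The growth fact used for the bookkeeping: `C n ≤ c 2ⁿ` eventually, for `c > 0`. -/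
theorem scanRung_eventually_linear_le (C : ℝ) {c : ℝ} (hc : 0 < c) :
    ∀ᶠ n : ℕ in atTop, C * n ≤ c * (2 : ℝ) ^ n := by
  have h1 : Tendsto (fun n : ℕ => C * ((n : ℝ) ^ 1 / 2 ^ n)) atTop (nhds (C * 0)) :=
    (tendsto_pow_const_div_const_pow_of_one_lt 1 one_lt_two).const_mul C
  rw [mul_zero] at h1
  filter_upwards [h1.eventually_le_const hc] with n hn
  rw [pow_one, ← mul_div_assoc, div_le_iff₀ (by positivity)] at hn
  exact hn

/-! ### The stub -/

/-- **Stub `stub_scanRung` (line `Sketch`, v9, A3) — padded finite-state scans of the `n` input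
bits.** From the uniform family bound `hFam` (`stub_automaticFamily`): for every `S` and `ε > 0`,
eventually in `n`, for ALL `S`-state automata `(δ, q₀, τ)` over the alphabet `Bool`, the function
scanning the bits `x₀, x₁, …, x_{n-1}` (`List.ofFn`, LSB first, the high zero bits included) and the
one scanning `x_{n-1}, …, x₀` are both `ε 2ⁿ`-orthogonal to `λ` on `N < 2ⁿ`. Dyadic induction on
`n` (`scanRung_dyadic`): one more high zero bit shifts the output map (LSB) or the initial state
(MSB) within the same finite family; on the block `2ʲ ≤ N < 2ʲ⁺¹` the padded scan is the automaton
reading `Nat.digits 2 N` (`scanRung_foldl_block`, `scanRung_foldl_reverse_block`), a difference of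
two partial sums controlled by `hFam` (`scanRung_block_bound`); total `3 ε' 2ⁿ + 2 N₀ n ≤ ε 2ⁿ`. -/
theorem stub_scanRung
    (hFam : ∀ (S : ℕ) (ε : ℝ), 0 < ε →
      ∃ N₀ : ℕ, ∀ N : ℕ, N₀ ≤ N → ∀ (δ : Fin S → ℕ → Fin S) (q₀ : Fin S) (τ : Fin S → Bool),
        |∑ m ∈ Finset.range (N + 1), (ArithmeticFunction.liouville m : ℝ) *
            sgn (τ ((Nat.digits 2 m).reverse.foldl δ q₀))| ≤ ε * N ∧
        |∑ m ∈ Finset.range (N + 1), (ArithmeticFunction.liouville m : ℝ) *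
            sgn (τ ((Nat.digits 2 m).foldl δ q₀))| ≤ ε * N)
    (S : ℕ) : ∀ ε : ℝ, 0 < ε → ∀ᶠ n : ℕ in atTop,
      ∀ (δ : Fin S → Bool → Fin S) (q₀ : Fin S) (τ : Fin S → Bool),
        |∑ N ∈ Finset.range (2 ^ n), ((ArithmeticFunction.liouville N : ℤ) : ℝ) *
            sgn (τ (List.foldl δ q₀ (List.ofFn fun i : Fin n => Nat.testBit N i)))| ≤ ε * (2 : ℝ) ^ n ∧
        |∑ N ∈ Finset.range (2 ^ n), ((ArithmeticFunction.liouville N : ℤ) : ℝ) *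
            sgn (τ (List.foldl δ q₀ (List.ofFn fun i : Fin n => Nat.testBit N i).reverse))| ≤ ε * (2 : ℝ) ^ n := by
  intro ε hε
  have hε' : (0 : ℝ) < ε / 6 := by positivity
  obtain ⟨N₀, hN₀⟩ := hFam S (ε / 6) hε'
  filter_upwards [scanRung_eventually_linear_le (2 * N₀ : ℝ) (half_pos hε)] with n hn δ q₀ τ
  -- the digit automaton of the family
  set δ' : Fin S → ℕ → Fin S := fun q d => δ q (decide (d = 1))
  constructor
  · -- LSB-first: shift the output map
    have key := scanRung_dyadic (P := Fin S → Bool)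
      (fun τ' n N => sgn (τ' (List.foldl δ q₀ (List.ofFn fun i : Fin n => Nat.testBit N i))))
      (fun τ' q => τ' (δ q false)) (3 * (ε / 6)) (2 * N₀)
      (fun τ' n N hN => by simp only [scanRung_foldl_succ δ q₀ hN])
      (fun τ' n => by
        rw [Finset.sum_congr rfl fun N hN => by
          rw [scanRung_foldl_block δ q₀ (mem_Ico.mp hN).1 (mem_Ico.mp hN).2]]
        exact scanRung_block_bound hε'.le (fun m => scanRung_abs_term_le m _)
          (fun M hM => (hN₀ M hM δ' q₀ τ').2) n)
      n τ
    calc _ ≤ 3 * (ε / 6) * (2 ^ n - 1) + 2 * N₀ * n := key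
      _ ≤ 3 * (ε / 6) * 2 ^ n + ε / 2 * 2 ^ n := add_le_add (by linarith) hn
      _ = ε * 2 ^ n := by ring
  · -- MSB-first: shift the initial state
    have key := scanRung_dyadic (P := Fin S)
      (fun q n N => sgn (τ (List.foldl δ q (List.ofFn fun i : Fin n => Nat.testBit N i).reverse)))
      (fun q => δ q false) (3 * (ε / 6)) (2 * N₀)
      (fun q n N hN => by simp only [scanRung_foldl_reverse_succ δ q hN])
      (fun q n => by
        rw [Finset.sum_congr rfl fun N hN => by
          rw [scanRung_foldl_reverse_block δ q (mem_Ico.mp hN).1 (mem_Ico.mp hN).2]]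
        exact scanRung_block_bound hε'.le (fun m => scanRung_abs_term_le m _)
          (fun M hM => (hN₀ M hM δ' q τ).1) n)
      n q₀
    calc _ ≤ 3 * (ε / 6) * (2 ^ n - 1) + 2 * N₀ * n := key
      _ ≤ 3 * (ε / 6) * 2 ^ n + ε / 2 * 2 ^ n := add_le_add (by linarith) hn
      _ = ε * 2 ^ n := by ring

end Summit.QuantumAdvantage.QuantumAdvantage.Theorems.LiouvilleOrthogonalTC0

end
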